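import Literature.Topology.FourManifolds.LefschetzBaseCircleMaps
import Literature.AlgebraicTopology.SingularHomology.CircleMapWinding
import HarnessLib

/-!
# The standard Lefschetz base of genus `g`, XV: windings of the circle maps on the chain loops;
# a loop with non-zero homology shadow winds non-trivially

Topic `Literature/Topology/FourManifolds`; namespace `Literature.Topology.FourManifolds.LefschetzBase`.
Sequel of `LefschetzBaseCircleMaps.lean` (the `2g` circle-valued maps `phi g j : Base g → ℝ/ℤ` of the
Milnor cover with their real lifts `FU`, `FV`) and of
`Literature/AlgebraicTopology/SingularHomology/CircleMapWinding.lean` (the winding functional of a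
circle-valued map on `H₁`).  Hatcher 2002, §2.2 p. 150 / Bott–Tu 1982, §2 in the language of
windings:

* `windAlong_symm`, `windAlong_trans`, `windAlong_cast`, `windAlong_congr` — the winding of a
  circle-valued map along paths is additive under concatenation and odd under reversal (glued and
  reflected lifts; generic, any space);
* `windAlong_phi_arcPath` — along the `i`-th arc lift `A^ε` (`V → U → V`, `LefschetzBaseShadowLoops`)
  the winding of `phi g j` is `FV(end) − FV(start) − χ_j(A^ε(sA)) + χ_j(A^ε(1 − sA))`
  (`windAlong_eq_sum_of_lifts` over the partition `0, sA, 1 − sA, 1`);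
* **`windAlong_phi_chainLoop`** — `windAlong (phi g j) (chainLoop g i) = [i + 1 ≤ j] − [i ≤ j]`
  (`= −δ_ij`) for `i < 2g`: the upper switch points lie in `C_j` according to `mem_Cset_up_sAI(')`,
  the lower ones never do (the twin of `theta_delta_altLoop`, on the side of maps to the circle);
* **`exists_windAlong_phi_ne_zero_of_loopClass_ne_zero`** — a loop of `Base g` with non-zero class
  in `H₁(Base g; ℤ)` winds non-trivially around some `phi g j`, `j < 2g` (the chain classes span
  `H₁`, by Milnor's theorem `exists_isChainShadow_of` and `chainVec_basis`; windings are additive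
  in homology, `windAlong_eq_sum_of_loopClass_eq_sum`);
* **`exists_windAlong_phi_ne_zero_of_shadow_ne_zero`** — in particular for every loop
  `K : 𝕊¹ → Base g` with `shadow g K ≠ 0`: the hypothesis "(2) homologically non-trivial vanishing
  cycle" of `Literature.Geometry.Symplectic.palf_stein_supportedByBoundaryOpenBook` in the form
  consumed by its Legendrian-realisation step (a closed `1`-form `d(phi g j)` with non-zero period on
  the attaching circle, `Literature/Geometry/Manifold/CircleMapForm.lean`).

Everything is proved; no definitions, no named facts.

## References
* A. Hatcher, *Algebraic Topology*, CUP 2002, §2.2 p. 150, §3.1 p. 198, Thm. 1.7. [HatcherAT2002]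
* R. Bott, L. W. Tu, *Differential Forms in Algebraic Topology* (1982), §2 Prop. 2.3. [BottTu1982Forms]
* J. Milnor, *Singular points of complex hypersurfaces* (1968), §9 Thm. 9.1. [Milnor1968]
-/

noncomputable section

open scoped Topology unitInterval
open Set Function Filter

/-! ### Windings along concatenated and reversed paths (generic) -/

namespace Literature.AlgebraicTopology.SingularHomology

section Algebra

variable {X : Type} [TopologicalSpace X] (φ : C(X, UnitAddCircle))

/-- Paths which agree pointwise have the same lift increment. [cite: HatcherAT2002, Prop. 1.30] -/
theorem liftIncrement_congr {a b a' b' : UnitAddCircle} {p : Path a b} {q : Path a' b'}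
    (h : ∀ t, p t = q t) : liftIncrement p = liftIncrement q := by
  rw [liftIncrement, liftIncrement, pathLift_congr h]

/-- Paths which agree pointwise have the same winding. [cite: HatcherAT2002, Prop. 1.30] -/
theorem windAlong_congr {x y x' y' : X} {p : Path x y} {q : Path x' y'} (h : ∀ t, p t = q t) :
    windAlong φ p = windAlong φ q :=
  liftIncrement_congr fun t => by
    show φ (p t) = φ (q t)
    rw [h t]

/-- Casting the end points does not change the winding. [folklore] -/
theorem windAlong_cast {x y x' y' : X} (p : Path x y) (hx : x' = x) (hy : y' = y) :
    windAlong φ (p.cast hx hy) = windAlong φ p :=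
  windAlong_congr φ fun _ => rfl

/-- **The winding along the reversed path is the opposite.** [cite: HatcherAT2002, Thm. 1.7] -/
theorem windAlong_symm {x y : X} (p : Path x y) : windAlong φ p.symm = -windAlong φ p := by
  set P := pathLift (p.map φ.continuous) with hP
  have hG : ∀ t, (((P (unitInterval.symm t)) : ℝ) : UnitAddCircle) = (p.symm.map φ.continuous) t :=
    fun t => by rw [coe_pathLift]; rfl
  rw [windAlong, liftIncrement_eq_of_lift _
    ⟨fun t => P (unitInterval.symm t), P.continuous.comp unitInterval.continuous_symm⟩ hG,
    windAlong, liftIncrement]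
  show P (unitInterval.symm 1) - P (unitInterval.symm 0) = -(P 1 - P 0)
  rw [unitInterval.symm_one, unitInterval.symm_zero]
  ring

/-- **The winding is additive under concatenation of paths** (glue the lift of the first piece
to the integer-shifted lift of the second). [cite: HatcherAT2002, Thm. 1.7] -/
theorem windAlong_trans {x y z : X} (p : Path x y) (q : Path y z) :
    windAlong φ (p.trans q) = windAlong φ p + windAlong φ q := by
  set P := pathLift (p.map φ.continuous) with hP
  set Q := pathLift (q.map φ.continuous) with hQ
  -- the jump `P 1 − Q 0` is an integer: both lift `φ y`
  have hPQ : ((P 1 : ℝ) : UnitAddCircle) = ((Q 0 : ℝ) : UnitAddCircle) := by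
    rw [coe_pathLift, coe_pathLift]
    show φ (p 1) = φ (q 0)
    rw [p.target, q.source]
  obtain ⟨k, hk⟩ := exists_int_eq_sub_of_coe_eq hPQ
  set G : ℝ → ℝ := fun t => if t ≤ 1 / 2 then IccExtend zero_le_one P (2 * t)
    else IccExtend zero_le_one Q (2 * t - 1) + k with hGdef
  have hGc : Continuous G := by
    refine Continuous.if_le ?_ ?_ continuous_id continuous_const ?_
    · exact P.continuous.Icc_extend'.comp (by fun_prop)
    · exact (Q.continuous.Icc_extend'.comp (by fun_prop)).add continuous_const
    · intro t ht
      rw [ht]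
      norm_num
      exact hk
  have hlift : ∀ t : I, ((G t : ℝ) : UnitAddCircle) = ((p.trans q).map φ.continuous) t := by
    intro t
    show ((G t : ℝ) : UnitAddCircle) = φ ((p.trans q) t)
    show (((if (t : ℝ) ≤ 1 / 2 then IccExtend zero_le_one P (2 * t)
      else IccExtend zero_le_one Q (2 * t - 1) + k) : ℝ) : UnitAddCircle) =
      φ (if (t : ℝ) ≤ 1 / 2 then p.extend (2 * t) else q.extend (2 * t - 1))
    split_ifs with h
    · show (((P (projIcc 0 1 zero_le_one (2 * (t : ℝ)))) : ℝ) : UnitAddCircle) =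
        φ (p (projIcc 0 1 zero_le_one (2 * (t : ℝ))))
      rw [coe_pathLift]
      rfl
    · rw [coe_add_intCast]
      show (((Q (projIcc 0 1 zero_le_one (2 * (t : ℝ) - 1))) : ℝ) : UnitAddCircle) =
        φ (q (projIcc 0 1 zero_le_one (2 * (t : ℝ) - 1)))
      rw [coe_pathLift]
      rfl
  rw [windAlong, liftIncrement_eq_of_lift _ ⟨fun t => G t, hGc.comp continuous_subtype_val⟩ hlift]
  show G 1 - G 0 = windAlong φ p + windAlong φ q
  have h1 : G 1 = Q 1 + k := by
    show (if (1 : ℝ) ≤ 1 / 2 then IccExtend zero_le_one P (2 * 1)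
      else IccExtend zero_le_one Q (2 * 1 - 1) + k) = Q 1 + k
    rw [if_neg (by norm_num)]
    norm_num
  have h0 : G 0 = P 0 := by
    show (if (0 : ℝ) ≤ 1 / 2 then IccExtend zero_le_one P (2 * 0)
      else IccExtend zero_le_one Q (2 * 0 - 1) + k) = P 0
    rw [if_pos (by norm_num)]
    norm_num
  rw [h1, h0, windAlong, windAlong, liftIncrement, liftIncrement, ← hP, ← hQ]
  linarith

end Algebra

end Literature.AlgebraicTopology.SingularHomology

/-! ### Windings of `phi g j` along the arcs and the chain loops -/

namespace Literature.Topology.FourManifolds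

namespace LefschetzBase

open Literature.AlgebraicTopology.SingularHomology
open Literature.AlgebraicTopology.FundamentalGroup.PathSegment (segment segment_apply)

variable {g : ℕ}

/-- **The winding of `phi g j` along an arc lift `A^ε`** (`V` on `[0, sA]`, `U` on `[sA, 1 − sA]`,
`V` on `[1 − sA, 1]`): `FV(end) − FV(start) − χ_j(A^ε(sA)) + χ_j(A^ε(1 − sA))`.
[cite: HatcherAT2002, §2.2 p. 150] -/
theorem windAlong_phi_arcPath (j i : ℕ) {ε : ℂ} (hε : ε ^ 2 = 1) :
    windAlong (phi g j) (arcPath g i ε hε) =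
      FV g j (chordEnd g (i + 1)) - FV g j (chordEnd g i)
        - chiC g j (arcPath g i ε hε sAI) + chiC g j (arcPath g i ε hε sAI') := by
  have h := windAlong_eq_sum_of_lifts (phi g j) (arcPath g i ε hε) (n := 3)
    ![0, sAI, sAI', 1] rfl rfl ![coverV g, coverU g, coverV g] ![FV g j, FU g j, FV g j]
    (fun k => by
      fin_cases k
      · exact continuousOn_FV j
      · exact continuousOn_FU j
      · exact continuousOn_FV j)
    (fun k => by
      fin_cases k
      · exact fun z hz => (phi_eq_coe_FV j hz).symm
      · exact fun z hz => (phi_eq_coe_FU j hz).symm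
      · exact fun z hz => (phi_eq_coe_FV j hz).symm)
    (fun k u => by
      fin_cases k
      · simpa [segment_apply, sAI] using seg0_mem (g := g) i hε u
      · simpa [segment_apply, sAI, sAI'] using seg1_mem (g := g) i hε u
      · simpa [segment_apply, sAI'] using seg2_mem (g := g) i hε u)
  rw [h, Fin.sum_univ_three]
  simp only [Matrix.cons_val_zero, Matrix.cons_val_one, Matrix.cons_val, Fin.succ_zero_eq_one,
    Fin.castSucc_zero, Fin.succ_one_eq_two, Fin.castSucc_one]
  have e0 : (arcPath g i ε hε) 0 = chordEnd g i := (arcPath g i ε hε).source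
  have e1 : (arcPath g i ε hε) 1 = chordEnd g (i + 1) := (arcPath g i ε hε).target
  have hs2 : (Fin.succ (2 : Fin 3)) = (3 : Fin 4) := rfl
  have hc2 : (Fin.castSucc (2 : Fin 3)) = (2 : Fin 4) := rfl
  simp only [hs2, hc2]
  show FV g j ((arcPath g i ε hε) sAI) - FV g j ((arcPath g i ε hε) 0) +
      (FU g j ((arcPath g i ε hε) sAI') - FU g j ((arcPath g i ε hε) sAI)) +
      (FV g j ((arcPath g i ε hε) 1) - FV g j ((arcPath g i ε hε) sAI')) = _
  rw [e0, e1]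
  have hu1 := FU_sub_FV (g := g) j ((arcPath g i ε hε) sAI)
  have hu2 := FU_sub_FV (g := g) j ((arcPath g i ε hε) sAI')
  linarith

/-- `χ_j` at the upper switch point `A⁺(sA)`: `[i ≤ j]`. [folklore] -/
theorem chiC_up_sAI (j i : ℕ) (hi : i + 1 < 2 * g + 1) :
    chiC g j (arcPath g i 1 (one_pow 2) sAI) = if i ≤ j then 1 else 0 := by
  by_cases h : i ≤ j
  · rw [if_pos h]
    exact chiC_eq_one j (mem_up_sAI i) ((mem_Cset_up_sAI i hi j).2 h)
  · rw [if_neg h]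
    exact chiC_eq_zero j (mem_up_sAI i) (fun hC => h ((mem_Cset_up_sAI i hi j).1 hC))

/-- `χ_j` at the upper switch point `A⁺(1 − sA)`: `[i + 1 ≤ j]`. [folklore] -/
theorem chiC_up_sAI' (j i : ℕ) (hi : i + 1 < 2 * g + 1) :
    chiC g j (arcPath g i 1 (one_pow 2) sAI') = if i + 1 ≤ j then 1 else 0 := by
  by_cases h : i + 1 ≤ j
  · rw [if_pos h]
    exact chiC_eq_one j (mem_up_sAI' i) ((mem_Cset_up_sAI' i hi j).2 h)
  · rw [if_neg h]
    exact chiC_eq_zero j (mem_up_sAI' i) (fun hC => h ((mem_Cset_up_sAI' i hi j).1 hC))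

/-- `χ_j` vanishes at the lower switch point `A⁻(sA)`. [folklore] -/
theorem chiC_dn_sAI (j i : ℕ) : chiC g j (arcPath g i (-1) (by norm_num) sAI) = 0 :=
  chiC_eq_zero j (mem_dn_sAI i) (not_mem_Cset_dn_sAI i j)

/-- `χ_j` vanishes at the lower switch point `A⁻(1 − sA)`. [folklore] -/
theorem chiC_dn_sAI' (j i : ℕ) : chiC g j (arcPath g i (-1) (by norm_num) sAI') = 0 :=
  chiC_eq_zero j (mem_dn_sAI' i) (not_mem_Cset_dn_sAI' i j)

/-- **`windAlong (phi g j) (chainLoop g i) = [i + 1 ≤ j] − [i ≤ j] = −δ_ij`** for `i < 2g`: the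
chain loop has the Hurewicz class of the arc loop `A⁺ · (A⁻)⁻¹`, the two arcs have the same end
points, and only the upper switch points can lie in `C_j`. [cite: HatcherAT2002, §2.2 p. 150] -/
theorem windAlong_phi_chainLoop (j i : ℕ) (hi : i + 1 < 2 * g + 1) :
    windAlong (phi g j) (chainLoop g i) =
      (if i + 1 ≤ j then (1 : ℝ) else 0) - (if i ≤ j then (1 : ℝ) else 0) := by
  rw [windAlong_eq_of_loopClass_eq (phi g j) (loopClass_chainLoop_eq_arcLoop ℤ ℤ (1 : ℤ) g i),
    arcLoop, windAlong_trans, windAlong_symm, windAlong_phi_arcPath, windAlong_phi_arcPath,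
    chiC_up_sAI j i hi, chiC_up_sAI' j i hi, chiC_dn_sAI, chiC_dn_sAI']
  ring

/-- The same with `i j : Fin (2g)`: `windAlong (phi g j) (chainLoop g i) = −δ_ij`. [folklore] -/
theorem windAlong_phi_chainLoop_fin (j i : Fin (2 * g)) :
    windAlong (phi g j) (chainLoop g i) = if i = j then (-1 : ℝ) else 0 := by
  rw [windAlong_phi_chainLoop (g := g) j i (by omega)]
  by_cases h : i = j
  · subst h
    simp
  · rw [if_neg h]
    have h' : (i : ℕ) ≠ j := fun e => h (Fin.ext e)
    by_cases h1 : (i : ℕ) + 1 ≤ j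
    · rw [if_pos h1, if_pos (by omega)]; ring
    · rw [if_neg h1, if_neg (by omega)]; ring

/-! ### Homologically non-trivial loops wind -/

/-- **The chain classes span `H₁(Base g; ℤ)`** (Milnor's Thm. 9.1 for the base: a bijective
shadow `σ` carries them to the basis `chainVec`). [cite: Milnor1968, Thm. 9.1] -/
theorem exists_eq_sum_loopClass_chainLoop (g : ℕ) (z : singularHomology ℤ ℤ (Base g) 1) :
    ∃ n : Fin (2 * g) → ℤ, z = ∑ i, n i • loopClass ℤ ℤ (1 : ℤ) (chainLoop g i) := by
  obtain ⟨sh, hsh⟩ := exists_isChainShadow_of g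
  have hshb : Function.Bijective sh := hsh.1
  have hshc : ∀ i, i < 2 * g → sh (loopClass ℤ ℤ (1 : ℤ) (chainLoop g i)) = chainVec g i := hsh.2
  obtain ⟨bV, hbV⟩ := chainVec_basis g
  refine ⟨fun i => bV.repr (sh z) i, hshb.1 ?_⟩
  rw [map_sum]
  conv_lhs => rw [← bV.sum_repr (sh z)]
  refine Finset.sum_congr rfl fun i _ => ?_
  rw [map_zsmul, hshc i (by omega), hbV]

/-- **A loop with non-zero class in `H₁(Base g; ℤ)` winds non-trivially around some `phi g j`.**
[cite: HatcherAT2002, §3.1 p. 198] -/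
theorem exists_windAlong_phi_ne_zero_of_loopClass_ne_zero {x : Base g} (γ : Path x x)
    (hγ : loopClass ℤ ℤ (1 : ℤ) γ ≠ 0) : ∃ j : Fin (2 * g), windAlong (phi g j) γ ≠ 0 := by
  obtain ⟨n, hn⟩ := exists_eq_sum_loopClass_chainLoop g (loopClass ℤ ℤ (1 : ℤ) γ)
  by_contra hall
  push Not at hall
  -- every coefficient vanishes
  have hcoef : ∀ j : Fin (2 * g), n j = 0 := by
    intro j
    have hw := windAlong_eq_sum_of_loopClass_eq_sum (phi g j) γ Finset.univ
      (fun i : Fin (2 * g) => chordEnd g i) (fun i => chainLoop g i) n hn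
    rw [hall j] at hw
    have hsum : ∑ i : Fin (2 * g), (n i : ℝ) * windAlong (phi g j) (chainLoop g i) = -(n j : ℝ) := by
      rw [Finset.sum_eq_single j]
      · rw [windAlong_phi_chainLoop_fin, if_pos rfl]; ring
      · intro i _ hij
        rw [windAlong_phi_chainLoop_fin, if_neg hij, mul_zero]
      · intro h; exact absurd (Finset.mem_univ j) h
    rw [hsum] at hw
    exact_mod_cast (neg_eq_zero.1 hw.symm)
  apply hγ
  rw [hn]
  simp [hcoef]

/-- **A loop `K : 𝕊¹ → Base g` with non-zero homology shadow winds non-trivially around some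
`phi g j`, `j < 2g`.**  This is hypothesis (2) of
`Literature.Geometry.Symplectic.palf_stein_supportedByBoundaryOpenBook` ("the vanishing cycle is
homologically non-trivial") in the form used by its Legendrian-realisation step.
[cite: Milnor1968, Thm. 9.1] -/
theorem exists_windAlong_phi_ne_zero_of_shadow_ne_zero
    (K : Metric.sphere (0 : EuclideanSpace ℝ (Fin 2)) 1 → Base g) (hK : Continuous K)
    (h : shadow g K hK ≠ 0) : ∃ j : Fin (2 * g), windAlong (phi g j) (loopPath K hK) ≠ 0 := by
  refine exists_windAlong_phi_ne_zero_of_loopClass_ne_zero _ fun h0 => h ?_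
  show shadowMap g (loopClass ℤ ℤ (1 : ℤ) (loopPath K hK)) = 0
  rw [h0, map_zero]

end LefschetzBase

end Literature.Topology.FourManifolds
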